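import Summits.BirchSwinnertonDyer.BirchSwinnertonDyer.Theorems.SmallImageMuTransferMuTransferX9KolyvaginClassTwistUnramified
import Summits.BirchSwinnertonDyer.BirchSwinnertonDyer.Theorems.SmallImageMuTransferMuTransferX9StepFourReciprocityTwist
import Literature.NumberTheory.EllipticCurves.IwasawaTwistModPTowerEmbed
import HarnessLib

/-!
# K6 crux `MuTransferX9` (stmt-BirchSwinnertonDyer-19276), stub `stub_selmerDualOdd` (skeleton v6),
# local lemma (L-ur), STEP (3): unramifiedness passes from `Y ∈ H¹(K, 𝒯_J)` to the `T`-embedded avatar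
# `Ψ ∈ H¹(K, 𝒯_{J'})` with `T^{J−J'}·Ψ = T^k Y`

Cell `bsd-smallim`, seat `bsd-smallim-k6-lur-b` (gen 0, strategy B: the inertia-values test).  HONEST
FRAMING: theorems only (no definition, no named fact, no `sorry`); nothing is asserted about any curve and
nothing is booked.  Helper toward the registered stub `stub_selmerDualOdd` of skeleton v6
(sha16 a90a661b046bb403) of crux 19276, precisely toward the local lemma (L-ur) = hypothesis `hLur` of
k6-c2's `SelmerDual.stub_selmerDualOdd_of_local` (p456301) in its corrected form (L-ur′) (with
`W.HasGoodReductionAt v`; see STATUS lur-a 17:54Z / lur-b 18:30Z); closes nothing.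

(L-ur′) is a chain `y ↦ y_n ↦ Y = Sh⁻¹(y_n) ↦ Ψ`: (1) a fine class `y ∈ H¹(K_∞, E[p])` gives a layer class
`y_n` whose cocycle vanishes on the inertia groups above a good `v ∤ p` (Castella (B′)); (2) the inverse
Shapiro map `coresShapiro` keeps this (x9 p459441 `exists_cocycle_coresShapiro_apply_eq_zero_of_forall_primesAbove`);
(3) THIS FILE: if `Y ∈ H¹(K, 𝒯_J(ρ, κ))` has a cocycle `F` vanishing on the inertia group `I_{𝔓₀}` of the
distinguished prime `𝔓₀ = adicCompletionPrime K v` above a finite `v ∤ p` where `ρ` is unramified, and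
`Ψ ∈ H¹(K, 𝒯_{J'})` satisfies `H¹(T^{J−J'}-embedding)(Ψ) = T^[k] Y` (the avatar of k6-c2's
`exists_level_class_of_shiftH1_iterate_ne_zero`, p454735), then `loc_v Ψ ∈ H¹_ur(K_v, 𝒯_{J'})`
(`localization_mem_unramifiedSubgroup_of_map_shiftEmbed_eq_iterate_shiftH1`).  Proof = the
inertia-values test: for a cocycle `ψ` of `Ψ`, `embed ∘ ψ` and `S^k ∘ F` are cohomologous, so they differ
by a coboundary `g ↦ g·m − m` of `𝒯_J`, which VANISHES on `I_{𝔓₀}` because `𝒯_J(ρ, κ)` is unramified at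
`v` (x10 `StepFour.isUnramifiedAt_twistModP`: `ρ` unramified and `κ(I) = 1`, Washington 13.2); hence
`embed (ψ g) = S^k (F g) = 0` and `ψ g = 0` (`shiftEmbed_injective`), and a global cocycle vanishing on
`I_{𝔓₀}` localises into `H¹_ur` (k6-g3 `localization_mem_unramifiedSubgroup_of_forall_inertia_apply_eq_zero`).
Also the pointwise variant for the local inertia `res(I_{K_v})` and the `E[p]`-specialisation
`localization_modPTwist_mem_unramifiedSubgroup_of_map_shiftEmbed_eq` in the exact currency of the
`hLur` binder (`W.modPTwist p κ₁`, `κ₁ = κ.invTwist` allowed).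

PARTITION (D-0054): X9 (A4) × p ∈ {5,7} (+ X10b∧¬Surj at 3) — helper toward `stub_selmerDualOdd`; closes none.

References: J.-P. Serre, *Galois Cohomology* (1997) I §2.2 (functoriality on cocycles), I §5.1
[SerreGaloisCohomology1997]; J. S. Milne, *Arithmetic Duality Theorems* (2006) I §2 (unramified classes)
[MilneADT2006]; L. Washington, *Introduction to Cyclotomic Fields* Prop. 13.2 [Washington1997];
B. Mazur, K. Rubin, Mem. AMS 799 (2004) §5.3 [MazurRubin2004]; HOME/koly/MU-TRANSFER-PROOF.md §5 STEP 1.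
-/

set_option linter.dupNamespace false
set_option autoImplicit false

noncomputable section

open scoped NumberField
open Field IsDedekindDomain NumberField
open WeierstrassCurve (geomTorsion)
open Literature.NumberTheory.GaloisRepresentations
open Literature.NumberTheory.EllipticCurves

universe u

namespace Summit.BirchSwinnertonDyer.BirchSwinnertonDyer.Rank1Residual.SelmerDualUnramified

/-! ## The `T^{J−J'}`-embedding is injective on values -/

section Embed

variable {M : Type u} [AddCommGroup M] (J : ℕ) {J' : ℕ} (hJ' : J' ≤ J)

/-- **`x ↦ T^{J−J'}·x : 𝒯_{J'} → 𝒯_J` is injective** (coordinate `i` of `x` is coordinate `i + (J − J')`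
of its image). [cite: Washington1997, §13.1–§13.2] -/
theorem shiftEmbed_injective : Function.Injective (ZpExtension.shiftEmbed (M := M) J hJ') := by
  intro x y hxy
  funext i
  have h := congrFun hxy ⟨(i : ℕ) + (J - J'), by omega⟩
  rw [ZpExtension.shiftEmbed_apply, ZpExtension.shiftEmbed_apply, dif_pos (by simp),
    dif_pos (by simp)] at h
  have hi : (⟨(i : ℕ) + (J - J') - (J - J'), by omega⟩ : Fin J') = i := Fin.ext (by simp)
  rwa [hi] at h

/-- `T^{J−J'}·x = 0 ↔ x = 0`. [cite: Washington1997, §13.1–§13.2] -/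
theorem shiftEmbed_eq_zero_iff (x : Fin J' → M) : ZpExtension.shiftEmbed J hJ' x = 0 ↔ x = 0 := by
  constructor
  · intro h
    apply shiftEmbed_injective J hJ'
    rw [h]
    funext i
    rw [ZpExtension.shiftEmbed_apply, Pi.zero_apply]
    split_ifs <;> rfl
  · rintro rfl
    funext i
    rw [ZpExtension.shiftEmbed_apply, Pi.zero_apply]
    split_ifs <;> rfl

end Embed

/-! ## STEP (3): `Y` unramified at `v` ⟹ the embedded avatar `Ψ` is unramified at `v` -/

section Transfer

variable {K : Type u} [Field K] [NumberField K] {p : ℕ} [Fact p.Prime] (κ : ZpExtension K p)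
  {M : Type u} [AddCommGroup M] [TopologicalSpace M] [DiscreteTopology M]
  (ρ : DiscreteGaloisModule K M) (hM : ∀ x : M, p • x = 0) (J : ℕ) {J' : ℕ} (hJ' : J' ≤ J)
  (v : HeightOneSpectrum (𝓞 K))

/-- **Cocycle form.** If `F` is a cocycle of `𝒯_J(ρ, κ)` vanishing on the inertia group `I_{𝔓₀}` of the
distinguished prime above a finite `v ∤ p` at which `ρ` is unramified, and `ψ` is a cocycle of `𝒯_{J'}`
with `H¹(embed)[ψ] = T^[k][F]`, then `ψ` vanishes on `I_{𝔓₀}`: `embed ∘ ψ − S^k ∘ F` is a coboundary of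
`𝒯_J`, and coboundaries die on `I_{𝔓₀}` since `𝒯_J(ρ, κ)` is unramified at `v`.
[cite: SerreGaloisCohomology1997, I §2.2 and I §5.1] [cite: Washington1997, Prop. 13.2] -/
theorem apply_eq_zero_of_map_shiftEmbed_eq_iterate_shiftH1
    (hur : GaloisRep.IsUnramifiedAt v ρ) (hvp : ((p : ℕ) : 𝓞 K) ∉ v.asIdeal)
    (F : contOneCocycles (κ.twistModP ρ hM J).toTopRep)
    (hF : ∀ g ∈ (adicCompletionPrime K v).inertia (absoluteGaloisGroup K), F.1 g = 0)
    (ψ : contOneCocycles (κ.twistModP ρ hM J').toTopRep) (k : ℕ)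
    (hψ : galoisCohomology.map (κ.twistModPShiftEmbed ρ hM J hJ') 1
        (oneCocycleClass (κ.twistModP ρ hM J').toTopRep ψ) =
      (κ.shiftH1 ρ hM J)^[k] (oneCocycleClass (κ.twistModP ρ hM J).toTopRep F)) :
    ∀ g ∈ (adicCompletionPrime K v).inertia (absoluteGaloisGroup K), ψ.1 g = 0 := by
  intro g hg
  -- the two cocycles of `𝒯_J`: `embed ∘ ψ` and `S^k ∘ F`
  rw [ZpExtension.map_oneCocycleClass_twist, ZpExtension.shiftH1_iterate_oneCocycleClass] at hψ
  have h0 : oneCocycleClass (κ.twistModP ρ hM J).toTopRep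
      (κ.pushCocycle ρ hM J' (κ.twistModPShiftEmbed ρ hM J hJ') ψ - κ.shiftPowCocycle ρ hM J k F) = 0 := by
    rw [oneCocycleClass_sub]
    exact sub_eq_zero.2 hψ
  obtain ⟨m, hm⟩ := (oneCocycleClass_eq_zero_iff _ _).1 h0
  have hgm := hm g
  -- `g ∈ I_{𝔓₀}` acts trivially on `𝒯_J`
  have htriv : (κ.twistModP ρ hM J).toTopRep.ρ g m = m := by
    change κ.twistModP ρ hM J g m = m
    rw [StepFour.isUnramifiedAt_twistModP κ ρ hM J v hur hvp _ (adicCompletionPrime_mem_primesAbove K v)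
      g hg, Module.End.one_apply]
  rw [htriv, sub_self, Submodule.coe_sub, ContinuousMap.sub_apply, ZpExtension.pushCocycle_apply,
    ZpExtension.shiftPowCocycle_apply, hF g hg, map_zero, sub_zero,
    ZpExtension.twistModPShiftEmbed_apply, shiftEmbed_eq_zero_iff] at hgm
  exact hgm

/-- **STEP (3) of (L-ur′), class form.** With `F`, `v` as above and `Ψ ∈ H¹(K, 𝒯_{J'}(ρ, κ))` with
`H¹(T^{J−J'}-embedding)(Ψ) = T^[k] [F]`: `loc_v Ψ ∈ H¹_ur(K_v, 𝒯_{J'})`.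
[cite: MilneADT2006, Ch. I §2 (unramified cohomology)] [cite: SerreGaloisCohomology1997, I §2.2 and I §5.1] -/
theorem localization_mem_unramifiedSubgroup_of_map_shiftEmbed_eq_iterate_shiftH1
    (hur : GaloisRep.IsUnramifiedAt v ρ) (hvp : ((p : ℕ) : 𝓞 K) ∉ v.asIdeal)
    (F : contOneCocycles (κ.twistModP ρ hM J).toTopRep)
    (hF : ∀ g ∈ (adicCompletionPrime K v).inertia (absoluteGaloisGroup K), F.1 g = 0)
    (Ψ : galoisCohomology (κ.twistModP ρ hM J') 1) (k : ℕ)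
    (hΨ : galoisCohomology.map (κ.twistModPShiftEmbed ρ hM J hJ') 1 Ψ =
      (κ.shiftH1 ρ hM J)^[k] (oneCocycleClass (κ.twistModP ρ hM J).toTopRep F)) :
    galoisCohomology.localization (κ.twistModP ρ hM J') (Sum.inr v) 1 Ψ ∈
      DiscreteGaloisModule.unramifiedSubgroup (GaloisRep.toLocal v (κ.twistModP ρ hM J')) 1 := by
  obtain ⟨ψ, rfl⟩ := oneCocycleClass_surjective _ Ψ
  exact KolyvaginTwist.localization_mem_unramifiedSubgroup_of_forall_inertia_apply_eq_zero
    (κ.twistModP ρ hM J') v ψ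
    (apply_eq_zero_of_map_shiftEmbed_eq_iterate_shiftH1 κ ρ hM J hJ' v hur hvp F hF ψ k hΨ)

/-- **Local-inertia form** (input = a cocycle of `Y` vanishing on `res(I_{K_v})`, the output shape of x9's
`CoresUnramified.exists_cocycle_coresShapiro_apply_absGaloisRestrict_eq_zero`; `res(I_{K_v}) = I_{𝔓₀}`,
`inertia_adicCompletionPrime_eq_map_absInertia`). [cite: NeukirchANT1999, Ch. II §9 Prop. (9.6)]
[cite: MilneADT2006, Ch. I §2 (unramified cohomology)] -/
theorem localization_mem_unramifiedSubgroup_of_map_shiftEmbed_eq_iterate_shiftH1'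
    (hur : GaloisRep.IsUnramifiedAt v ρ) (hvp : ((p : ℕ) : 𝓞 K) ∉ v.asIdeal)
    (F : contOneCocycles (κ.twistModP ρ hM J).toTopRep)
    (hF : ∀ i ∈ absInertia (v.adicCompletion K), F.1 (absGaloisRestrict K (v.adicCompletion K) i) = 0)
    (Ψ : galoisCohomology (κ.twistModP ρ hM J') 1) (k : ℕ)
    (hΨ : galoisCohomology.map (κ.twistModPShiftEmbed ρ hM J hJ') 1 Ψ =
      (κ.shiftH1 ρ hM J)^[k] (oneCocycleClass (κ.twistModP ρ hM J).toTopRep F)) :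
    galoisCohomology.localization (κ.twistModP ρ hM J') (Sum.inr v) 1 Ψ ∈
      DiscreteGaloisModule.unramifiedSubgroup (GaloisRep.toLocal v (κ.twistModP ρ hM J')) 1 := by
  refine localization_mem_unramifiedSubgroup_of_map_shiftEmbed_eq_iterate_shiftH1 κ ρ hM J hJ' v hur hvp
    F (fun g hg => ?_) Ψ k hΨ
  rw [inertia_adicCompletionPrime_eq_map_absInertia] at hg
  obtain ⟨i, hi, rfl⟩ := hg
  exact hF i hi

/-- **All-primes form** (input = a cocycle of `Y` vanishing on `I_𝔓` for EVERY `𝔓 ∣ v`, the output shape of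
x9's `CoresUnramified.exists_cocycle_coresShapiro_apply_eq_zero_of_forall_primesAbove`).
[cite: MilneADT2006, Ch. I §2 (unramified cohomology)] -/
theorem localization_mem_unramifiedSubgroup_of_map_shiftEmbed_eq_iterate_shiftH1_of_forall_primesAbove
    (hur : GaloisRep.IsUnramifiedAt v ρ) (hvp : ((p : ℕ) : 𝓞 K) ∉ v.asIdeal)
    (F : contOneCocycles (κ.twistModP ρ hM J).toTopRep)
    (hF : ∀ 𝔓 ∈ v.primesAbove, ∀ g ∈ 𝔓.inertia (absoluteGaloisGroup K), F.1 g = 0)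
    (Ψ : galoisCohomology (κ.twistModP ρ hM J') 1) (k : ℕ)
    (hΨ : galoisCohomology.map (κ.twistModPShiftEmbed ρ hM J hJ') 1 Ψ =
      (κ.shiftH1 ρ hM J)^[k] (oneCocycleClass (κ.twistModP ρ hM J).toTopRep F)) :
    galoisCohomology.localization (κ.twistModP ρ hM J') (Sum.inr v) 1 Ψ ∈
      DiscreteGaloisModule.unramifiedSubgroup (GaloisRep.toLocal v (κ.twistModP ρ hM J')) 1 :=
  localization_mem_unramifiedSubgroup_of_map_shiftEmbed_eq_iterate_shiftH1 κ ρ hM J hJ' v hur hvp F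
    (hF _ (adicCompletionPrime_mem_primesAbove K v)) Ψ k hΨ

end Transfer

/-! ## The `E[p]` specialisation in the currency of the `hLur` binder -/

section Curve

variable (W : WeierstrassCurve ℚ) (p : ℕ) [Fact p.Prime] (κ₁ : ZpExtension ℚ p)

/-- **STEP (3) of (L-ur′) for `𝒯_•(E, κ₁) = W.modPTwist p κ₁ •`** (any `κ₁`, so also the dual twist
`κ.invTwist` of the stub): at a finite `v ∤ p` with `E[p]` unramified, if `Y ∈ H¹(ℚ, 𝒯_{p^n}(E, κ₁))` has a
cocycle vanishing on every inertia group above `v` and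
`H¹(twistModPShiftEmbed (p^n) hJn)(Ψ) = (shiftH1 (p^n))^[k] Y` (the binders `Y Ψ k` and the third relation
of `hLur` VERBATIM), then `loc_v Ψ ∈ H¹_ur(ℚ_v, 𝒯_{J+1}(E, κ₁))` — the conclusion of `hLur` VERBATIM.
[cite: MilneADT2006, Ch. I §2 (unramified cohomology)] [cite: SerreGaloisCohomology1997, I §2.2 and I §5.1] -/
theorem localization_modPTwist_mem_unramifiedSubgroup_of_map_shiftEmbed_eq
    {v : HeightOneSpectrum (𝓞 ℚ)} (hvp : ((p : ℕ) : 𝓞 ℚ) ∉ v.asIdeal)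
    (hvur : GaloisRep.IsUnramifiedAt v (W.torsionGaloisModule (p : ℤ)))
    {J n : ℕ} (hJn : J + 1 ≤ p ^ n)
    (F : contOneCocycles (W.modPTwist p κ₁ (p ^ n)).toTopRep)
    (hF : ∀ 𝔓 ∈ v.primesAbove, ∀ g ∈ 𝔓.inertia (absoluteGaloisGroup ℚ), F.1 g = 0)
    (Y : galoisCohomology (W.modPTwist p κ₁ (p ^ n)) 1)
    (hY : oneCocycleClass (W.modPTwist p κ₁ (p ^ n)).toTopRep F = Y)
    (Ψ : galoisCohomology (W.modPTwist p κ₁ (J + 1)) 1) (k : ℕ)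
    (hΨemb : galoisCohomology.map (κ₁.twistModPShiftEmbed (W.torsionGaloisModule (p : ℤ))
        (fun P : WeierstrassCurve.geomTorsion W (p : ℤ) => AddSubgroup.torsionBy.nsmul P) (p ^ n) hJn)
        1 Ψ =
      (κ₁.shiftH1 (W.torsionGaloisModule (p : ℤ))
        (fun P : WeierstrassCurve.geomTorsion W (p : ℤ) => AddSubgroup.torsionBy.nsmul P)
        (p ^ n))^[k] Y) :
    galoisCohomology.localization (W.modPTwist p κ₁ (J + 1)) (Sum.inr v) 1 Ψ ∈
      DiscreteGaloisModule.unramifiedSubgroup (GaloisRep.toLocal v (W.modPTwist p κ₁ (J + 1))) 1 := by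
  subst hY
  exact localization_mem_unramifiedSubgroup_of_map_shiftEmbed_eq_iterate_shiftH1_of_forall_primesAbove κ₁
    (W.torsionGaloisModule (p : ℤ)) (fun P => AddSubgroup.torsionBy.nsmul P) (p ^ n) hJn v hvur hvp F hF
    Ψ k hΨemb

end Curve

end Summit.BirchSwinnertonDyer.BirchSwinnertonDyer.Rank1Residual.SelmerDualUnramified

end
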